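import Literature.AlgebraicGeometry.HodgeTheory.ClassesSupportedOn
import HarnessLib

/-!
# Colliot-Thélène–Voisin (2012), Théorème 3.1: the Zariski sheaves `𝓗ⁱ_X(ℤ)` are torsion-free
# — elementary form: a torsion Betti class on a Zariski open dies on a smaller Zariski open

Topic `Literature/AlgebraicGeometry/HodgeTheory`. Named fact (Literature is sorry-free; users take
`(h : ColliotTheleneVoisin2012_torsionDiesGenerically)`), vendored by a grounder for route
`GenericDivisibility` of the summit `HodgeConjecture`.

**The printed theorem.** J.-L. Colliot-Thélène, C. Voisin, *Cohomologie non ramifiée et conjecture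
de Hodge entière*, Duke Math. J. 161 (2012) 735–801 = arXiv:1005.2778, §3.1, Théorème 3.1 (arXiv
p. 7, verbatim): *"Soit `X` une variété algébrique connexe sur `ℂ`. Pour tout entier `i`, la
multiplication par un entier `n > 0` sur les faisceaux `𝓗ᵖ_X(ℤ(i))` induit des suites exactes courtes
de faisceaux Zariski sur `X`, `0 → 𝓗ᵖ_X(ℤ(i)) →(×n) 𝓗ᵖ_X(ℤ(i)) → 𝓗ᵖ_X(μ_n^{⊗i}) → 0`. En particulier
les faisceaux `𝓗ᵖ_X(ℤ(i))` sont sans torsion, et donc leurs groupes de sections globales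
`H⁰(X, 𝓗ᵖ_X(ℤ(i))) = Hᵖ_nr(X, ℤ(i))` sont sans torsion."* Here (§2.1, arXiv p. 4) `𝓗ⁱ_X(A)` is
"le faisceau pour la topologie de Zariski sur `X` associé au préfaisceau `U ↦ Hⁱ(U(ℂ), A)`"
(Betti = singular cohomology of the complex points with the classical topology), and the proof
rests on the Bloch–Kato conjecture, now the norm-residue isomorphism theorem (Voevodsky–Rost), so the
statement is unconditional. (Translation: multiplication by `n > 0` on the Zariski sheaf
`𝓗ᵖ_X(ℤ(i))` is injective with cokernel `𝓗ᵖ_X(μ_n^{⊗i})`; in particular these sheaves, and the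
unramified cohomology groups, are torsion-free.)

**The form recorded.** The tree has no Zariski sheaf `𝓗ⁱ_X(ℤ)` (no sheafified Betti cohomology,
no unramified cohomology), so we record the theorem UNWOUND on presheaf sections, in the single
instance the route consumes (`i = 0`, degree `p = 2k` on a smooth projective `2k`-fold; `ℤ(i) ≅ ℤ`
as a coefficient group): injectivity of `×N` on the SHEAF `𝓗^{2k}_X(ℤ)` says exactly that a presheaf
section `w ∈ H^{2k}(U(ℂ); ℤ)` over a Zariski open `U = X ∖ Z` with `N·w = 0` has zero image in the
sheafification, i.e. is Zariski-LOCALLY zero on `U`; restricting to one non-empty member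
`V = X ∖ Z'` (`Z ⊆ Z'` closed, `Z' ≠ X`) of such a covering gives `w|_{V(ℂ)} = 0`. (For `X`
disconnected apply the theorem on each connected component and take the union of the opens.) This
is an instantiation plus the definition of the sheafification, not new mathematics; it is the
statement filed verbatim as the support item
`Summit.HodgeConjecture.HodgeConjecture.Theses.GenericDivisibility.TorsionDiesGenerically`
(stmt-HodgeConjecture-18469), which this fact grounds (item = fact, `Iff.rfl` up to binder names),
and the "Bloch–Kato shadow" used by every line on the crux `HodgeClassesGenericallyDivisible`.

## Mathlib / tree search

Mathlib: no Betti cohomology of schemes, no Bloch–Ogus theory, no norm-residue theorem. Tree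
(`lean search unramified|BlochOgus|nrCohomology`): nothing on unramified cohomology; the vocabulary
used below (`Motives.SchemeOver`, `Motives.IsSmoothProjective`, `Motives.complexPointsCompl`,
`singularCohomology`, `complexPointsComplInclusion`) is the accepted one of
`HodgeTheory/ClassesSupportedOn.lean` and `AlgebraicTopology/SingularHomology`.

## References

* [ColliotTheleneVoisin2012] J.-L. Colliot-Thélène, C. Voisin, *Cohomologie non ramifiée et
  conjecture de Hodge entière*, Duke Math. J. 161 (2012) 735–801, doi:10.1215/00127094-1548389,
  arXiv:1005.2778: §2.1 (the sheaves `𝓗ⁱ_X(A)`), Thm. 3.1 (arXiv p. 7).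
* S. Bloch, V. Srinivas, *Remarks on correspondences and algebraic cycles*, Amer. J. Math. 105
  (1983) — the argument generalised in §3.1.
-/

noncomputable section

open CategoryTheory AlgebraicGeometry

namespace Literature.AlgebraicGeometry.HodgeTheory

open Literature.AlgebraicTopology.SingularHomology Literature.AlgebraicGeometry.Motives

/-- **Colliot-Thélène–Voisin 2012, Théorème 3.1** (the Zariski sheaf `𝓗^{2k}_X(ℤ)` of Betti
cohomology is torsion-free — a THEOREM, proved in the source from the norm-residue isomorphism
theorem of Voevodsky–Rost), in elementary form on a smooth projective complex `2k`-fold `X`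
(`k ≥ 1`): an integral singular cohomology class `w ∈ H^{2k}((X ∖ Z)(ℂ); ℤ)` on the complex points
of a non-empty Zariski open (`Z` closed, `Z ≠ X`) that is killed by some `N ≥ 1` restricts to zero on
the complex points of a smaller non-empty Zariski open `X ∖ Z'`, `Z ⊆ Z'` closed, `Z' ≠ X`
(printed: *"les faisceaux `𝓗ᵖ_X(ℤ(i))` sont sans torsion"*, i.e. `×N` is injective on the
sheafification of `U ↦ Hᵖ(U(ℂ); ℤ)`, so an `N`-torsion presheaf section is Zariski-locally zero).
Grounds the support item `GenericDivisibility.TorsionDiesGenerically` (stmt id 18469 of the Hodge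
summit), verbatim. [cite: ColliotTheleneVoisin2012, Thm 3.1] -/
def ColliotTheleneVoisin2012_torsionDiesGenerically : Prop :=
  ∀ ⦃p : ℕ⦄ ⦃X : SchemeOver ℂ⦄, 1 ≤ p → IsSmoothProjective (2 * p) X →
    ∀ (Z : Set X.left), IsClosed Z → Z ≠ Set.univ →
    ∀ (w : singularCohomology ℤ ℤ (complexPointsCompl X Z) (2 * p)) (N : ℕ), 1 ≤ N → N • w = 0 →
      ∃ (Z' : Set X.left) (h : Z ⊆ Z'), IsClosed Z' ∧ Z' ≠ Set.univ ∧
        singularCohomology.map ℤ ℤ (complexPointsComplInclusion h) (2 * p) w = 0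

end Literature.AlgebraicGeometry.HodgeTheory

end
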